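import Summits.QuantumFields.YangMills.Theorems.BalabanUVNodesN16AtRRec12On
import Summits.QuantumFields.YangMills.Theorems.BalabanUVNodesN21EndLettersDefs
import HarnessLib

/-!
# Route «BalabanUVNodes», cluster K4 «SpineRates» — node N16 = NE3: THE CLASS-RADIUS LETTER OF THE SLOT LIVES IN N05's AVERAGING WINDOW —
# (§1) a kernel CERTIFICATE that `PrintSlot c` ∕ `LeafSlot c` force `c.ε < c2' 4 c.L ∕ 2 = 1∕(40960·L²)` and `c.ε < 1∕1056`, so that every pin of the NE3
# letters with `ε = radiusOfRecord …` (this lineage's «canonical letters», dag-n21-d's `endLettersN21`) turns the slot into an UPPER BOUND ON AN OPAQUE CHOSEN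
# CONSTANT (not certifiably inhabitable); (§2) THE WINDOW RECIPE, def-free and letter-parametric: with the class radius tuned DOWN into N05's window the
# leaf-form slot at RR-1's object IS its three content clauses, and the proviso holds; (§3) windowed letters, THE END's proviso and N21's numerals TOGETHER

Cell `pub-ymgap`, seat `pub-ymgap-dag-n16-e` (R134 acceleration seat (a), strategy s2 = BY-NAME KNIT at the record; HUMAN RULING D-0062; chair R424 venue),
generation 4, file 13 (THEOREMS ONLY, 0 `def`, 0 `sorry`, standard axioms).  `bears_on: R4∕N16 · K3′ SpineGivenEndpointR12 (stmt-QuantumFields-19908)`.  Filed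
`--supports stmt-QuantumFields-19908 --as helper`.  Imports this seat's file 12 `BalabanUVNodesN16AtRRec12On` (p474753; through it `LeafSlot`, `PrintSlot`, `InEndRegime`,
`radiusOfRecord`, `constOfRecord`, RR-1's `ne3ConstLayerOfRecord₁₁`) and dag-n21-d's module 11a `BalabanUVNodesN21EndLettersDefs` (p471025: `endLettersN21`, READ in §1
only).  Restates nothing; cites by name.  File 14 `BalabanUVNodesN16SlotWindowReading` composes §2 into the N16 line at the reading of record.

WHY (LOCATED-3 of this seat, pub-ymgap INBOX l.14710, 2026-08-27T00:30Z).  `LeafSlot c` (file 7) — like `PrintSlot c` (file 1) — displays [Balaban1985RegularSpaces]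
Theorem 4's averaging-window lines for a letter `α`: `c.ε < α`, `2α ≤ c2' 4 c.L`, `11·4²·α ≤ 1∕6`, … .  Hence `c.ε < c2' 4 c.L ∕ 2` and `c.ε < 1∕1056` at every bundle
carrying the slot (§1).  THE END's class radius `r = radiusOfRecord N L Nper` is a `Classical.choose` (file 1 :151) of which only `0 < r` is knowable; so the theorems
of this lineage that pin the reading's NE3 letters at `ε = r` (g2 `inEndRegime_ne3OfRecord₁₁_canonical` ∕ `…_canonical_of_leafSlot`, g3 `…_of_letters_of_leafSlot` with
`⟨r, b, g, C, r, Λ₂'⟩`) and dag-n21-d's tuned letters `endLettersN21 F N g Λ₂'` (`ε = Λ₁ = r`, read by `spine_rec12C_of_homes₁₂_readingOfRecord₁₂_tuned_of_leafSlot`) carry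
an N16-slot hypothesis which IMPLIES `r < 1∕(40960·L²)` — neither provable nor refutable in the tree: kernel-fine, NOT CERTIFIABLY INHABITABLE (the referees' A2 «is the
knit vacuous?» has no answer).  THE END's regime tolerates EVERY `0 < ε ≤ r` (`InEndRegime`; RR-1: «which letters a family carries stays the consumer's»), and file 10
(`exists_letters_inEndRegime_leafSlot`) already showed — in ∃-form, with `b = 0` — that a SMALL `ε` inside N05's window makes the slot its three content clauses.  THIS
FILE makes that recipe EXPLICIT and LETTER-PARAMETRIC (no definition, so every consumer — N21's `b⋆`, N19's budget — instantiates it) and certifies that windowed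
letters, the proviso and N21's two numerals hold together.

CONTENT ([folklore] bookkeeping + elementary real arithmetic on OUR displayed lines).
§1 `c2'_four_half`; `eps_lt_of_printSlot`, `eps_lt_of_leafSlot` (`c.ε < c2' 4 c.L ∕ 2 ∧ c.ε < 1∕1056`); at RR-1's layer `letters_eps_lt_of_leafSlot_ofRecord` ∕
   `…_of_printSlot_ofRecord`; the pins at the top of the tolerance: `radiusOfRecord_lt_of_leafSlot_ofRecord_top`, `radiusOfRecord_lt_of_leafSlot_endLettersN21`.
§2 `leafSlot_ofRecord_of_window` — at a family `F` and ANY NE3 object `o` (RR-1's `NE3Objects₁₁ N`): N05's constants `(c₁, c₁', B₁', cP, C₂, B₀β, inp)` with the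
   eleven-line window at `c₁'`, a length function `len`, an averaging letter `α` under FIVE displayed upper bounds (`c₁'∕177`, `o.Λ₁∕(1770·B+1)` with `B = 5·4·F.L·B₀`,
   `c2' 4 F.L ∕ 2`, `1∕((M_L+12)(1+K_L)+1)` with `M_L = 23040·4⁴·(frameC 4 F.L+4)³`, `K_L = curConst 4 F.L`, and `10⁻⁹`), bundle letters `o.ε < α`, `0 < o.Λ₁`,
   `177·α·(B_h+B) ≤ o.Λ₂'` (`B_h = 5·4·F.L·B₀β`), N07's leaf letters `0 ≤ b', c' ≤ α²`: the three CONTENT clauses (`B8.Thm4Body`, `B8.Prop3Body` on the univ sub-family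
   of `zdGF3 (M_N ℂ) F.L 1 len`, `LeafH3sup 4 F.L o.Nper o.ε b' c' o.dom`) ⟹ `LeafSlot (ne3OfRecord₁₁ F o)`.  `inEndRegime_ofRecord_of_window` — the proviso at such
   letters (`1 ≤ o.Nper`, `0 < o.g`, `0 < o.ε < α ≤ o.Λ₁∕(1770·B+1)`, `o.Λ₁ ≤ r`, `0 ≤ o.b ≤ o.ε∕2`, `Cof ≤ o.C`).
§3 `exists_window_letters_numerals` — for every family, window `c₁' > 0`, inputs `inp`, `B₀β`, coupling letter `g > 0`: letters `(α, ℓ)` meeting ALL of §2's lines with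
   `ℓ.Λ₁ = r`, `0 < ℓ.b`, `0 < ℓ.Λ₂'`, THE END's proviso AND dag-n21-d's regularity numeral `512·(4+1)·(4+4)·L²·ℓ.b ≤ 1` EXIST (`ε = α∕2`,
   `b = min (α∕4) (1∕(512·5·8·L²))`, `Λ₂' = max 1 (177α(B_h+B))`) — the repaired joint N16∕N21 line is letter-wise non-vacuous.

HONEST FRAMING.  Kernel bookkeeping + real arithmetic on OUR displayed lines; no estimate of Bałaban's; the three content clauses stay HYPOTHESES (N05's leaf modulo its
sockets — as typed, at Hölder exponent `β = 1`: dag-n16-c LOCATED-N16-HOLDER-PIN, ruling awaited; N07's [Balaban1985Variational] Thm 1 (8)+(10) TYPE); `radiusOfRecord` ∕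
`constOfRecord` are file 1's `Classical.choose` thresholds; dag-n21-d's files are NOT edited; **N16 ∕ NE3 NOT discharged**; count-neutral; one finite four-torus at fixed ε —
NOT ℝ⁴, NOT infinite volume, NOT OS, NOT a mass gap, NOT Clay.
-/

set_option autoImplicit false

open scoped BigOperators Matrix Matrix.Norms.L2Operator
open NormedSpace

namespace Summit.QuantumFields.YangMills.BalabanUVNodes.N16SlotWindow

open Literature.MathematicalPhysics.QuantumFieldTheory.Balaban1983to89
open Literature.MathematicalPhysics.QuantumFieldTheory.Balaban1983to89.T4Continuum (T4Family ULoop)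
open B7Prop1Explicit B7Prop2Explicit
open B7Prop3Flat (c3)
open B8LeafModelZd (ZdIdx)
open B8LeafModelZd3 (zdGF3)
open Node00 (NE3Objects₁₁ NE3Letters₁₁ ne3ConstLayerOfRecord₁₁ ne3NperOfRecord₁₁)
open Summit.QuantumFields.BalabanUV.T4Continuum
open BlockAverageCurrent (curConst curConst_nonneg)
open NE3RightInverseSupLetters (frameC)
open NE3.LeafIndexSockets (LeafH3sup)
open YMDAG.UVSplit (NE3Carriers ne3OfRecord₁₁)
open Summit.QuantumFields.YangMills.BalabanUVNodes.N16Regime (PrintSlot InEndRegime radiusOfRecord constOfRecord)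
open Summit.QuantumFields.YangMills.BalabanUVNodes.N16AtRateRecord11 (inEndRegime_ne3Objects_iff)
open Summit.QuantumFields.YangMills.BalabanUVNodes.N16LeafSlot (LeafSlot)
open Summit.QuantumFields.YangMills.BalabanUVNodes.N16AtRRec12OfRecord (radiusOfRecord_ofRecord_pos inEndRegime_ofRecord_iff)
open Summit.QuantumFields.YangMills.BalabanUVNodes.N21EndLetters (endLettersN21)

noncomputable section

variable {N : ℕ}

/-! ## §1 The certificate: the slot bounds the class-radius letter from above -/

/-- The number behind the window line: `c2' 4 L ∕ 2 = 1∕(40960·L²)` ([Balaban1985Averaging]'s `c₂′(d, L) = 1∕(512(d+1)(d+4)L²)` at `d = 4`). [folklore] -/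
theorem c2'_four_half (L : ℕ) : c2' 4 L / 2 = 1 / (40960 * (L : ℝ) ^ 2) := by
  unfold c2'; push_cast; ring

/-- **THE PRINT-FORM SLOT BOUNDS THE CLASS RADIUS FROM ABOVE**: `PrintSlot c → c.ε < c2' 4 c.L ∕ 2 ∧ c.ε < 1∕1056` — from its displayed window lines `c.ε < α`,
`2α ≤ c2' 4 c.L`, `11·4²·α ≤ 1∕6`. [folklore] -/
theorem eps_lt_of_printSlot (c : NE3Carriers N) (h : PrintSlot c) : c.ε < c2' 4 c.L / 2 ∧ c.ε < 1 / 1056 := by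
  obtain ⟨-, -, -, -, -, α, -, -, -, -, -, -, -, -, -, hA2, hAs, -, -, -, -, -, -, -, hεα, -⟩ := h
  exact ⟨by linarith only [hεα, hA2], by linarith only [hεα, hAs]⟩

/-- **THE LEAF-FORM SLOT BOUNDS THE CLASS RADIUS FROM ABOVE**: `LeafSlot c → c.ε < c2' 4 c.L ∕ 2 ∧ c.ε < 1∕1056` (same three window lines). [folklore] -/
theorem eps_lt_of_leafSlot (c : NE3Carriers N) (h : LeafSlot c) : c.ε < c2' 4 c.L / 2 ∧ c.ε < 1 / 1056 := by
  obtain ⟨-, -, -, -, -, -, -, -, -, -, -, -, α, -, -, -, -, -, -, -, -, -, -, -, -, -, -, -, -, -, hA2, hAs, -, -, -, -, -, -, -, hεα, -⟩ := h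
  exact ⟨by linarith only [hεα, hA2], by linarith only [hεα, hAs]⟩

/-- **AT RR-1's OBJECT OF RECORD, THE LEAF-FORM SLOT BOUNDS THE LETTER `ℓ.ε`**: `LeafSlot (ne3OfRecord₁₁ F (ne3ConstLayerOfRecord₁₁ F N ℓ)) → ℓ.ε < c2' 4 F.L ∕ 2 ∧ ℓ.ε < 1∕1056`
(faces `rfl`: the bundle's block factor is `F.L`, its radius `ℓ.ε`). [folklore] -/
theorem letters_eps_lt_of_leafSlot_ofRecord (F : T4Family) (ℓ : NE3Letters₁₁) (h : LeafSlot (ne3OfRecord₁₁ F (ne3ConstLayerOfRecord₁₁ F N ℓ))) :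
    ℓ.ε < c2' 4 F.L / 2 ∧ ℓ.ε < 1 / 1056 :=
  eps_lt_of_leafSlot _ h

/-- The print-form twin at RR-1's object of record. [folklore] -/
theorem letters_eps_lt_of_printSlot_ofRecord (F : T4Family) (ℓ : NE3Letters₁₁) (h : PrintSlot (ne3OfRecord₁₁ F (ne3ConstLayerOfRecord₁₁ F N ℓ))) :
    ℓ.ε < c2' 4 F.L / 2 ∧ ℓ.ε < 1 / 1056 :=
  eps_lt_of_printSlot _ h

variable [NeZero N]

/-- **A PIN AT THE TOP OF THE TOLERANCE TURNS THE SLOT INTO A BOUND ON THE OPAQUE RADIUS**: if the reading's letters put `ℓ.ε = radiusOfRecord N F.L (2·L^m)` (this lineage's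
canonical letters `⟨r, ·, ·, ·, r, ·⟩`), then `LeafSlot` at RR-1's object of record implies `radiusOfRecord N F.L (2·L^m) < c2' 4 F.L ∕ 2` — an inequality about a
`Classical.choose` constant of which only positivity is knowable: the hypothesis is not certifiably inhabitable. [folklore] -/
theorem radiusOfRecord_lt_of_leafSlot_ofRecord_top (F : T4Family) (ℓ : NE3Letters₁₁) (hε : ℓ.ε = radiusOfRecord N F.L (ne3NperOfRecord₁₁ F 0 0))
    (h : LeafSlot (ne3OfRecord₁₁ F (ne3ConstLayerOfRecord₁₁ F N ℓ))) :
    radiusOfRecord N F.L (ne3NperOfRecord₁₁ F 0 0) < c2' 4 F.L / 2 ∧ radiusOfRecord N F.L (ne3NperOfRecord₁₁ F 0 0) < 1 / 1056 :=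
  hε ▸ letters_eps_lt_of_leafSlot_ofRecord F ℓ h

/-- **THE INSTANCE AT dag-n21-d's TUNED LETTERS `endLettersN21 F N g Λ₂'`** (`ε = Λ₁ = r`, module 11a :53): the N16-slot hypothesis of
`N21AtReadingOfRecord12.spine_rec12C_of_homes₁₂_readingOfRecord₁₂_tuned_of_leafSlot` implies `radiusOfRecord N F.L (2·L^m) < c2' 4 F.L ∕ 2 ∧ … < 1∕1056`. [folklore] -/
theorem radiusOfRecord_lt_of_leafSlot_endLettersN21 (F : T4Family) (g Λ₂' : ℝ)
    (h : LeafSlot (ne3OfRecord₁₁ F (ne3ConstLayerOfRecord₁₁ F N (endLettersN21 F N g Λ₂')))) :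
    radiusOfRecord N F.L (ne3NperOfRecord₁₁ F 0 0) < c2' 4 F.L / 2 ∧ radiusOfRecord N F.L (ne3NperOfRecord₁₁ F 0 0) < 1 / 1056 :=
  radiusOfRecord_lt_of_leafSlot_ofRecord_top F _ rfl h

/-! ## §2 The window recipe: with the class radius inside N05's window the leaf-form slot is its three content clauses -/

/-! ### Arithmetic helpers (tiny contexts, so that `nlinarith` stays cheap) -/

/-- `α² + K·α⁴ ≤ α²(1+K)` for `0 ≤ α ≤ 1`, `0 ≤ K`. [folklore] -/
private theorem sq_poly_le {α K : ℝ} (h0 : 0 ≤ α) (h1 : α ≤ 1) (hK : 0 ≤ K) :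
    α ^ 2 + K * (α ^ 2) ^ 2 ≤ α ^ 2 * (1 + K) := by
  have h4 : (α ^ 2) ^ 2 ≤ α ^ 2 := by
    have : α ^ 2 ≤ 1 := by nlinarith
    nlinarith [sq_nonneg α]
  nlinarith

/-- If `α·((M+12)(1+K)+1) ≤ 1` then `M·(α² + Kα⁴) ≤ 1` and `12·(α² + Kα⁴) < α` (`0 < α ≤ 1`, `0 ≤ M, K`). [folklore] -/
private theorem lines_of_small {α M K : ℝ} (h0 : 0 < α) (h1 : α ≤ 1) (hM : 0 ≤ M) (hK : 0 ≤ K) (h : α * ((M + 12) * (1 + K) + 1) ≤ 1) :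
    M * (α ^ 2 + K * (α ^ 2) ^ 2) ≤ 1 ∧ 4 * ((4 : ℝ) - 1) * (α ^ 2 + K * (α ^ 2) ^ 2) < α := by
  have hp := sq_poly_le h0.le h1 hK
  have hq : 0 ≤ α ^ 2 + K * (α ^ 2) ^ 2 := by positivity
  have hαM : α * (M * (1 + K)) ≤ 1 - α := by nlinarith
  have hα12 : α * (12 * (1 + K)) ≤ 1 - α := by nlinarith
  constructor
  · calc M * (α ^ 2 + K * (α ^ 2) ^ 2) ≤ M * (α ^ 2 * (1 + K)) := mul_le_mul_of_nonneg_left hp hM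
      _ = α * (α * (M * (1 + K))) := by ring
      _ ≤ α * (1 - α) := mul_le_mul_of_nonneg_left hαM h0.le
      _ ≤ 1 := by nlinarith
  · calc 4 * ((4 : ℝ) - 1) * (α ^ 2 + K * (α ^ 2) ^ 2) ≤ 12 * (α ^ 2 * (1 + K)) := by nlinarith
      _ = α * (α * (12 * (1 + K))) := by ring
      _ ≤ α * (1 - α) := mul_le_mul_of_nonneg_left hα12 h0.le
      _ < α := by nlinarith

/-- The (3.35) size `X = α² + C·α⁴` is below `α` once `α·(1 + C) < 1` (`0 < α ≤ 1`, `0 ≤ C`). [folklore] -/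
private theorem size335_lt {α C : ℝ} (h0 : 0 < α) (h1 : α ≤ 1) (hC : 0 ≤ C) (h : α * (1 + C) < 1) :
    α ^ 2 + C * (α ^ 2) ^ 2 < α := by
  have hp := sq_poly_le h0.le h1 hC
  calc α ^ 2 + C * (α ^ 2) ^ 2 ≤ α ^ 2 * (1 + C) := hp
    _ = α * (α * (1 + C)) := by ring
    _ < α * 1 := mul_lt_mul_of_pos_left h h0
    _ = α := mul_one α

omit [NeZero N] in
/-- **THE WINDOW RECIPE — `LeafSlot` AT RR-1's OBJECT FROM ITS THREE CONTENT CLAUSES, LETTER-PARAMETRIC.**  At a family `F` and an NE3 object `o`, given N05's constants with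
the eleven-line window at `c₁'` and `5·4·F.L·B₀ ≤ B₁'`, an averaging letter `α` under the five displayed upper bounds, bundle letters `o.ε < α`, `0 < o.Λ₁`,
`177·α·(B_h + B) ≤ o.Λ₂'` (`B = 5·4·F.L·B₀`, `B_h = 5·4·F.L·B₀β`) and N07's leaf letters `0 ≤ b', c' ≤ α²`: N05's `Thm4Body`, `Prop3Body` on the univ sub-family of
`zdGF3 (M_N ℂ) F.L 1 len` and N07's `LeafH3sup 4 F.L o.Nper o.ε b' c' o.dom` give `LeafSlot (ne3OfRecord₁₁ F o)` — with `Mc = 0`, `𝒬 ≡ ∅`, `C₃₃₅ = 1`.  The class radius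
is NOT pinned at THE END's `r`; it only has to lie below `α`. [folklore] -/
theorem leafSlot_ofRecord_of_window (F : T4Family) (o : NE3Objects₁₁ N)
    {len : Site 4 → ℝ} (hlen : ∀ v : Site 4, 0 < len v → 1 ≤ len v) (hlen1 : ∀ μ : Fin 4, len (e μ) = 1)
    {c₁ c₁' B₁' cP C₂ B₀β : ℝ} {inp : B8.B9Inputs} (hB₁' : 0 < B₁') (hBB : 5 * ((4 : ℕ) : ℝ) * F.L * inp.B₀ ≤ B₁') (hc₁' : 0 < c₁')
    (hwin : ∀ α₀ α₁ : ℝ, 0 < α₀ → 0 < α₁ → α₀ + α₁ ≤ c₁' →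
      α₀ + α₁ ≤ c₁ ∧ C0 4 * (2 * α₀) ≤ 1 / 3 ∧ 4 * α₀ ≤ c2' 4 F.L ∧ 16 * (B₁' * (α₀ + α₁)) ≤ 1 ∧
      Real.exp (4 * (800 * (((4 : ℕ) : ℝ) + 1) ^ 2 * (((4 : ℕ) : ℝ) + 4)) * α₀) * (1 + 8 * (131072 * (((4 : ℕ) : ℝ) + 1) ^ 2) * (B₁' * (α₀ + α₁))) ≤ 2 ∧
      2 * (B₁' * (α₀ + α₁)) ≤ c3 4 F.L ∧ ((4 : ℕ) : ℝ) * F.L * α₁ ≤ 1 / 8 ∧ α₀ ≤ cP ∧ α₁ ≤ cP ∧ B₁' * (α₀ + α₁) ≤ cP ∧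
      2 * (B₁' * (α₀ + α₁)) ^ 2 + 20 * ((4 : ℕ) : ℝ) * α₀ * (B₁' * (α₀ + α₁)) + 2 * C₂ * (B₁' * (α₀ + α₁)) ^ 2 ≤ α₀ + α₁)
    {α : ℝ} (hα : 0 < α) (hα1 : α ≤ c₁' / 177) (hα2 : α ≤ o.Λ₁ / (1770 * (5 * ((4 : ℕ) : ℝ) * F.L * inp.B₀) + 1))
    (hα3 : α ≤ c2' 4 F.L / 2) (hα4 : α ≤ 1 / ((23040 * (4 : ℝ) ^ 4 * (frameC 4 F.L + 4) ^ 3 + 12) * (1 + curConst 4 F.L) + 1))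
    (hα5 : α ≤ 1 / 10 ^ 9)
    (hε : o.ε < α) (hΛ₁ : 0 < o.Λ₁) (hΛ₂' : 177 * α * (5 * ((4 : ℕ) : ℝ) * F.L * B₀β + 5 * ((4 : ℕ) : ℝ) * F.L * inp.B₀) ≤ o.Λ₂')
    {b' c' : ℝ} (hb' : 0 ≤ b') (hb'α : b' ≤ α ^ 2) (hc' : 0 ≤ c') (hc'α : c' ≤ α ^ 2) :
    letI : CStarAlgebra (Matrix (Fin N) (Fin N) ℂ) := {}
    B8.Thm4Body c₁ B₁' (fun i : {i : ZdIdx 4 F.L // i.Ω 0 = Set.univ} => (zdGF3 (Matrix (Fin N) (Fin N) ℂ) F.L 1 len i.1).toGFData) →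
      B8.Prop3Body cP 4 (F.L : ℝ) C₂ inp B₀β
        (fun i : {i : ZdIdx 4 F.L // i.Ω 0 = Set.univ} => (zdGF3 (Matrix (Fin N) (Fin N) ℂ) F.L 1 len i.1).toGFData2) →
      LeafH3sup 4 F.L o.Nper o.ε b' c' o.dom →
      LeafSlot (ne3OfRecord₁₁ F o) := by
  letI : CStarAlgebra (Matrix (Fin N) (Fin N) ℂ) := {}
  intro hT hP h3
  have hL : 2 ≤ F.L := HistoryFlow.two_le_L F
  have hL1 : 1 ≤ F.L := le_trans one_le_two hL
  have hL0 : (0 : ℝ) < F.L := by exact_mod_cast lt_of_lt_of_le one_pos hL1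
  have hB₀ := inp.B₀_pos
  -- N05's output constants
  obtain ⟨B, hB_def, hB0⟩ : ∃ B : ℝ, B = 5 * ((4 : ℕ) : ℝ) * F.L * inp.B₀ ∧ 0 < B := ⟨_, rfl, by positivity⟩
  obtain ⟨Bh, hBh_def⟩ : ∃ Bh : ℝ, Bh = 5 * ((4 : ℕ) : ℝ) * F.L * B₀β := ⟨_, rfl⟩
  rw [← hB_def] at hα2
  rw [← hBh_def, ← hB_def] at hΛ₂'
  have h16 : 16 * (B * c₁') ≤ 1 := by
    obtain ⟨-, -, -, h, -⟩ := hwin (c₁' / 2) (c₁' / 2) (by linarith) (by linarith) (by linarith)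
    have h' : 16 * (B₁' * c₁') ≤ 1 := by rwa [add_halves] at h
    have hBB' : B ≤ B₁' := hB_def ▸ hBB
    linarith only [h', mul_le_mul_of_nonneg_right hBB' hc₁'.le]
  -- the big constant of the frame line, the current constant
  obtain ⟨M, hM_def, hM0⟩ : ∃ M : ℝ, M = 23040 * (4 : ℝ) ^ 4 * (frameC 4 F.L + 4) ^ 3 ∧ 0 ≤ M :=
    ⟨_, rfl, by have : 0 ≤ frameC 4 F.L := by unfold frameC; positivity
                positivity⟩
  rw [← hM_def] at hα4
  have hcur : 0 ≤ curConst 4 F.L := curConst_nonneg (d := 4) F.L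
  have hα_le_one : α ≤ 1 := hα5.trans (by norm_num)
  -- the (3.35) size at `α²` and at N07's `b' ≤ α²`
  have hXα : α ^ 2 + 226 * (8 * ((4 : ℝ) + 1) * ((4 : ℝ) + 4)) ^ 2 * (α ^ 2) ^ 2 < α :=
    size335_lt hα hα_le_one (by positivity) (by linarith only [hα5, hα])
  have hb'2 : b' ^ 2 ≤ (α ^ 2) ^ 2 := pow_le_pow_left₀ hb' hb'α 2
  have hXmono : b' + 226 * (8 * ((4 : ℝ) + 1) * ((4 : ℝ) + 4)) ^ 2 * b' ^ 2 ≤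
      α ^ 2 + 226 * (8 * ((4 : ℝ) + 1) * ((4 : ℝ) + 4)) ^ 2 * (α ^ 2) ^ 2 :=
    add_le_add hb'α (mul_le_mul_of_nonneg_left hb'2 (by positivity))
  have hX0 : 0 ≤ b' + 226 * (8 * ((4 : ℝ) + 1) * ((4 : ℝ) + 4)) ^ 2 * b' ^ 2 := by positivity
  have hXlt : b' + 226 * (8 * ((4 : ℝ) + 1) * ((4 : ℝ) + 4)) ^ 2 * b' ^ 2 < α := lt_of_le_of_lt hXmono hXα
  have hXs : b' + 226 * (8 * ((4 : ℝ) + 1) * ((4 : ℝ) + 4)) ^ 2 * b' ^ 2 ≤ 1 / 10 ^ 9 := hXmono.trans (hXα.le.trans hα5)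
  -- the frame line and the current line from `α·((M+12)(1+K_cur)+1) ≤ 1`, by monotonicity in `(b', c')`
  have hden : 0 < (M + 12) * (1 + curConst 4 F.L) + 1 := by positivity
  have hαK : α * ((M + 12) * (1 + curConst 4 F.L) + 1) ≤ 1 := by
    rw [le_div_iff₀ hden] at hα4; exact hα4
  obtain ⟨hcFα, hYα⟩ := lines_of_small hα hα_le_one hM0 hcur hαK
  have hYmono : c' + curConst 4 F.L * b' ^ 2 ≤ α ^ 2 + curConst 4 F.L * (α ^ 2) ^ 2 :=
    add_le_add hc'α (mul_le_mul_of_nonneg_left hb'2 hcur)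
  have hcF : 23040 * (4 : ℝ) ^ 4 * (frameC 4 F.L + 4) ^ 3 * (c' + curConst 4 F.L * b' ^ 2) ≤ 1 := by
    rw [← hM_def]; exact (mul_le_mul_of_nonneg_left hYmono hM0).trans hcFα
  have hY : 4 * ((4 : ℝ) - 1) * (c' + curConst 4 F.L * b' ^ 2) < α :=
    lt_of_le_of_lt (mul_le_mul_of_nonneg_left hYmono (by norm_num)) hYα
  -- the regularity line from `α ≤ c₂′∕2`, `α ≤ 10⁻⁹`, `b' ≤ α²`
  have hRb : 2 ^ 15 * ((4 : ℝ) + 1) ^ 2 * ((4 : ℝ) + 4) ^ 2 * (F.L : ℝ) ^ 2 * b' ≤ 1 := by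
    have hpos : (0 : ℝ) < (F.L : ℝ) ^ 2 := by positivity
    have hL2α : (F.L : ℝ) ^ 2 * α ≤ 1 / 40960 := by
      have e : c2' 4 F.L / 2 = (1 / 40960) / (F.L : ℝ) ^ 2 := by
        unfold c2'; push_cast; field_simp; ring
      rw [e, le_div_iff₀ hpos] at hα3
      linarith only [hα3]
    calc 2 ^ 15 * ((4 : ℝ) + 1) ^ 2 * ((4 : ℝ) + 4) ^ 2 * (F.L : ℝ) ^ 2 * b'
        ≤ 2 ^ 15 * ((4 : ℝ) + 1) ^ 2 * ((4 : ℝ) + 4) ^ 2 * (F.L : ℝ) ^ 2 * α ^ 2 :=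
          mul_le_mul_of_nonneg_left hb'α (by positivity)
      _ = 52428800 * (((F.L : ℝ) ^ 2 * α) * α) := by ring
      _ ≤ 52428800 * ((1 / 40960) * (1 / 10 ^ 9)) :=
          mul_le_mul_of_nonneg_left (mul_le_mul hL2α hα5 hα.le (by norm_num)) (by norm_num)
      _ ≤ 1 := by norm_num
  -- the α-lines
  have hA3 : C0 4 * α ≤ 1 / 3 := by unfold C0; push_cast; linarith only [hα5, hα]
  have hA2 : 2 * α ≤ c2' 4 F.L := by linarith only [hα3]
  have hAs : 11 * (4 : ℝ) ^ 2 * α ≤ 1 / 6 := by linarith only [hα5]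
  have hAc : α + 11 * (4 : ℝ) ^ 2 * α ≤ c₁' := by
    rw [le_div_iff₀ (by norm_num : (0 : ℝ) < 177)] at hα1; linarith only [hα1]
  -- the Λ-lines with `A = α + 11·16·α = 177·α`
  have hA0 : 0 ≤ α + 11 * (4 : ℝ) ^ 2 * α := by positivity
  have hBA : B * (α + 11 * (4 : ℝ) ^ 2 * α) ≤ o.Λ₁ / 10 := by
    have hden' : 0 < 1770 * B + 1 := by positivity
    rw [le_div_iff₀ hden'] at hα2
    rw [le_div_iff₀ (by norm_num : (0 : ℝ) < 10)]
    have e : B * (α + 11 * (4 : ℝ) ^ 2 * α) * 10 = α * (1770 * B + 1) - α := by ring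
    rw [e]; linarith only [hα2, hα]
  have hBA0 : 0 ≤ B * (α + 11 * (4 : ℝ) ^ 2 * α) := mul_nonneg hB0.le hA0
  have hss : B * (α + 11 * (4 : ℝ) ^ 2 * α) ≤ o.Λ₁ := by linarith only [hBA, hΛ₁]
  have hgrad : B * (α + 11 * (4 : ℝ) ^ 2 * α) +
      2 * (b' + 226 * (8 * ((4 : ℝ) + 1) * ((4 : ℝ) + 4)) ^ 2 * b' ^ 2) * o.Λ₁ ≤ o.Λ₁ := by
    nlinarith only [hBA, hXs, hX0, hΛ₁]
  have hℓ : B * (α + 11 * (4 : ℝ) ^ 2 * α) +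
      16 * (b' + 226 * (8 * ((4 : ℝ) + 1) * ((4 : ℝ) + 4)) ^ 2 * b' ^ 2) * (B * (α + 11 * (4 : ℝ) ^ 2 * α)) ≤ o.Λ₁ := by
    nlinarith only [hBA, hXs, hX0, hBA0, hΛ₁]
  have hhol : Bh * (α + 11 * (4 : ℝ) ^ 2 * α) +
      8 * (b' + 226 * (8 * ((4 : ℝ) + 1) * ((4 : ℝ) + 4)) ^ 2 * b' ^ 2) * (B * (α + 11 * (4 : ℝ) ^ 2 * α)) ≤ o.Λ₂' := by
    have h8 : 8 * (b' + 226 * (8 * ((4 : ℝ) + 1) * ((4 : ℝ) + 4)) ^ 2 * b' ^ 2) * (B * (α + 11 * (4 : ℝ) ^ 2 * α)) ≤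
        B * (α + 11 * (4 : ℝ) ^ 2 * α) := by
      nlinarith only [hXs, hX0, hBA0]
    have e : Bh * (α + 11 * (4 : ℝ) ^ 2 * α) + B * (α + 11 * (4 : ℝ) ^ 2 * α) = 177 * α * (Bh + B) := by ring
    linarith only [h8, e.le, hΛ₂']
  exact ⟨len, c₁, c₁', B₁', cP, C₂, B₀β, inp, B, Bh, b', c', α, 0, 1, fun _ => ∅, hlen, hlen1, hB₁', hBB, hB_def, hBh_def, h16, hwin,
    hb', hc', hRb, hcF, hα, hA3, hA2, hAs, hAc, hXlt, hY, le_rfl, by linarith only [hXs], fun _ _ hq => hq.elim, by linarith only [hXs], hε,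
    hss, hgrad, hℓ, hhol, hT, hP, h3⟩

/-- **THE PROVISO AT WINDOWED LETTERS**: an NE3 object at family `F` with period `≥ 1`, positive coupling letter, class radius `0 < o.ε < α ≤ o.Λ₁∕(1770·B+1)` (any `B ≥ 0`),
`o.Λ₁ ≤ radiusOfRecord N F.L o.Nper`, regularity letter `0 ≤ o.b ≤ o.ε∕2` and constant `≥ constOfRecord …` lies in THE END's regime of record — the class radius below the
window letter is AUTOMATICALLY below THE END's radius. [folklore] -/
theorem inEndRegime_ofRecord_of_window (F : T4Family) (o : NE3Objects₁₁ N) (hN : 1 ≤ o.Nper) (hg : 0 < o.g) {B : ℝ} (hB : 0 ≤ B) {α : ℝ}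
    (hα2 : α ≤ o.Λ₁ / (1770 * B + 1)) (hε0 : 0 < o.ε) (hε : o.ε < α) (hΛ₁r : o.Λ₁ ≤ radiusOfRecord N F.L o.Nper)
    (hb0 : 0 ≤ o.b) (hb : o.b ≤ o.ε / 2) (hC : constOfRecord N F.L o.Nper o.g ≤ o.C) :
    InEndRegime (ne3OfRecord₁₁ F o) := by
  have hden : 0 < 1770 * B + 1 := by positivity
  have hαΛ : α * (1770 * B + 1) ≤ o.Λ₁ := (le_div_iff₀ hden).1 hα2
  have hα : 0 < α := hε0.trans hε
  have hαΛ' : α ≤ o.Λ₁ := by nlinarith only [hαΛ, hB, hα]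
  have hΛ₁ : 0 ≤ o.Λ₁ := by linarith only [hα, hαΛ']
  exact (inEndRegime_ne3Objects_iff F o).2 ⟨hN, hg, hε0, by linarith only [hε, hαΛ', hΛ₁r], hΛ₁, hΛ₁r, hb0, hb, hC⟩

/-! ## §3 The windowed letters, THE END's proviso and N21's numerals hold TOGETHER -/

/-- **THE REPAIRED JOINT LINE IS LETTER-WISE NON-VACUOUS.**  For every family `F`, window `c₁' > 0`, N05 inputs `inp`, `B₀β`, and coupling letter `g > 0` there are an averaging
letter `α` under the five displayed bounds and NE3 letters `ℓ = ⟨α∕2, min (α∕4) (1∕(512·5·8·L²)), g, constOfRecord … g, r, max 1 (177α(B_h+B))⟩` (`r = radiusOfRecord N F.L (2·L^m)`)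
meeting §3's letter lines, THE END's proviso at RR-1's object of record, dag-n21-d's regularity numeral `512·(4+1)·(4+4)·L²·ℓ.b ≤ 1` with `0 < ℓ.b`, and `0 < ℓ.Λ₂'`. [folklore] -/
theorem exists_window_letters_numerals (F : T4Family) {c₁' : ℝ} (hc₁' : 0 < c₁') (inp : B8.B9Inputs) (B₀β : ℝ) {g : ℝ} (hg : 0 < g) :
    ∃ (α : ℝ) (ℓ : NE3Letters₁₁),
      0 < α ∧ α ≤ c₁' / 177 ∧ α ≤ ℓ.Λ₁ / (1770 * (5 * ((4 : ℕ) : ℝ) * F.L * inp.B₀) + 1) ∧ α ≤ c2' 4 F.L / 2 ∧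
      α ≤ 1 / ((23040 * (4 : ℝ) ^ 4 * (frameC 4 F.L + 4) ^ 3 + 12) * (1 + curConst 4 F.L) + 1) ∧ α ≤ 1 / 10 ^ 9 ∧
      ℓ.g = g ∧ 0 < ℓ.ε ∧ ℓ.ε < α ∧ ℓ.Λ₁ = radiusOfRecord N F.L (ne3NperOfRecord₁₁ F 0 0) ∧ 0 < ℓ.b ∧ ℓ.b ≤ ℓ.ε / 2 ∧
      ℓ.C = constOfRecord N F.L (ne3NperOfRecord₁₁ F 0 0) g ∧
      177 * α * (5 * ((4 : ℕ) : ℝ) * F.L * B₀β + 5 * ((4 : ℕ) : ℝ) * F.L * inp.B₀) ≤ ℓ.Λ₂' ∧ 0 < ℓ.Λ₂' ∧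
      512 * (4 + 1) * (4 + 4) * (F.L : ℝ) ^ 2 * ℓ.b ≤ 1 ∧
      InEndRegime (ne3OfRecord₁₁ F (ne3ConstLayerOfRecord₁₁ F N ℓ)) := by
  have hL : 2 ≤ F.L := HistoryFlow.two_le_L F
  have hL0 : (0 : ℝ) < F.L := by exact_mod_cast lt_of_lt_of_le one_pos (le_trans one_le_two hL)
  have hB₀ := inp.B₀_pos
  -- THE END's radius at the object of record and N05's output constant
  obtain ⟨r, hr_def, hr⟩ : ∃ r : ℝ, r = radiusOfRecord N F.L (ne3NperOfRecord₁₁ F 0 0) ∧ 0 < r := ⟨_, rfl, radiusOfRecord_ofRecord_pos F⟩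
  obtain ⟨B, hB_def, hB0⟩ : ∃ B : ℝ, B = 5 * ((4 : ℕ) : ℝ) * F.L * inp.B₀ ∧ 0 < B := ⟨_, rfl, by positivity⟩
  obtain ⟨M, hM_def, hM0⟩ : ∃ M : ℝ, M = 23040 * (4 : ℝ) ^ 4 * (frameC 4 F.L + 4) ^ 3 ∧ 0 ≤ M :=
    ⟨_, rfl, by have : 0 ≤ frameC 4 F.L := by unfold frameC; positivity
                positivity⟩
  have hcur : 0 ≤ curConst 4 F.L := curConst_nonneg (d := 4) F.L
  have hc2 : 0 < c2' 4 F.L := c2'_pos 4 F.L (le_trans one_le_two hL)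
  -- the averaging letter
  obtain ⟨α, hα, hα1, hα2, hα3, hα4, hα5⟩ : ∃ α : ℝ, 0 < α ∧ α ≤ c₁' / 177 ∧ α ≤ r / (1770 * B + 1) ∧ α ≤ c2' 4 F.L / 2 ∧
      α ≤ 1 / ((M + 12) * (1 + curConst 4 F.L) + 1) ∧ α ≤ 1 / 10 ^ 9 := by
    refine ⟨min (min (c₁' / 177) (r / (1770 * B + 1))) (min (c2' 4 F.L / 2) (min (1 / ((M + 12) * (1 + curConst 4 F.L) + 1)) (1 / 10 ^ 9))),
      lt_min (lt_min (by positivity) (by positivity)) (lt_min (by positivity) (lt_min (by positivity) (by norm_num))), ?_, ?_, ?_, ?_, ?_⟩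
    · exact (min_le_left _ _).trans (min_le_left _ _)
    · exact (min_le_left _ _).trans (min_le_right _ _)
    · exact (min_le_right _ _).trans (min_le_left _ _)
    · exact (min_le_right _ _).trans ((min_le_right _ _).trans (min_le_left _ _))
    · exact (min_le_right _ _).trans ((min_le_right _ _).trans (min_le_right _ _))
  have hαr : α ≤ r := hα2.trans (div_le_self hr.le (by linarith only [hB0]))
  -- the regularity letter inside THE END's tolerance and N21's numeral
  have hK : 0 < 512 * (4 + 1) * (4 + 4) * (F.L : ℝ) ^ 2 := by positivity
  obtain ⟨b, hb_def, hb0, hb1, hb2⟩ : ∃ b : ℝ, b = min (α / 4) (1 / (512 * (4 + 1) * (4 + 4) * (F.L : ℝ) ^ 2)) ∧ 0 < b ∧ b ≤ α / 4 ∧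
      b ≤ 1 / (512 * (4 + 1) * (4 + 4) * (F.L : ℝ) ^ 2) :=
    ⟨_, rfl, lt_min (by positivity) (by positivity), min_le_left _ _, min_le_right _ _⟩
  refine ⟨α, ⟨α / 2, b, g, constOfRecord N F.L (ne3NperOfRecord₁₁ F 0 0) g, r,
      max 1 (177 * α * (5 * ((4 : ℕ) : ℝ) * F.L * B₀β + 5 * ((4 : ℕ) : ℝ) * F.L * inp.B₀))⟩,
    hα, hα1, ?_, hα3, ?_, hα5, rfl, half_pos hα, half_lt_self hα, hr_def, hb0, ?_, rfl, le_max_right _ _, lt_max_of_lt_left one_pos, ?_, ?_⟩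
  · change α ≤ r / (1770 * (5 * ((4 : ℕ) : ℝ) * F.L * inp.B₀) + 1)
    rw [← hB_def]; exact hα2
  · rw [← hM_def]; exact hα4
  · change b ≤ α / 2 / 2
    linarith only [hb1]
  · calc 512 * (4 + 1) * (4 + 4) * (F.L : ℝ) ^ 2 * b
        ≤ 512 * (4 + 1) * (4 + 4) * (F.L : ℝ) ^ 2 * (1 / (512 * (4 + 1) * (4 + 4) * (F.L : ℝ) ^ 2)) := mul_le_mul_of_nonneg_left hb2 hK.le
      _ = 1 := by field_simp
  · refine (inEndRegime_ofRecord_iff F _).2 ⟨hg, half_pos hα, ?_, hr.le, hr_def.le, hb0.le, ?_, le_rfl⟩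
    · change α / 2 ≤ radiusOfRecord N F.L (ne3NperOfRecord₁₁ F 0 0)
      rw [← hr_def]; linarith only [hαr, hα]
    · change b ≤ α / 2 / 2
      linarith only [hb1]

end

end Summit.QuantumFields.YangMills.BalabanUVNodes.N16SlotWindow
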